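import Literature.NumberTheory.Automorphic.ArchTorusOrbitalFunction      -- ★ p837696: circle-torus hygiene, the fixed-quotient torus term, the regular-point bridge
import Literature.NumberTheory.Automorphic.CompactGroupOrbitalIntegral   -- ★ p836603∕p836777 (p08): `continuous_integral_conj`, `integral_quotientMeasure_eq_inv_smul` (via ★ InvariantQuotientCompactSubgroup)
import HarnessLib

/-!
# The fixed-quotient torus orbital function UNFOLDED (`F_f(z) = t_T(T_w)⁻¹ · ∫_{G_w} f(g·diag z·g⁻¹) dν` at every `z`), and at a DEFINITE place:
# continuity and boundedness on the whole torus, `D^{1∕2}·F_f → 0` at the singular points (road D2′ (V2)-Q ∕ (L-cpt); Rogawski 1990 §14.5 p. 238, §8.2)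

Topic `NumberTheory/Automorphic`; namespace `Literature.NumberTheory.Automorphic.UnitaryGroup`.  THEOREMS ONLY (no `def`, no instance, no notation, no axiom, no
`sorry`).  Cell `pub/hodgecm-mathlib`, ENGINE T1 (crux H413 = `stmt-HodgeConjecture-24833`); floor-1 preparation, count-neutral, under books rows #111 (S-d) ∕ #88 (ST-∞)
(F0P3a-p02 (g8)'s CENSUS-D2prime-HClimit §2 (L-cpt) «COMPACT FACTOR … in-house, NOT a letter», §4 (V2); LEAD DESK WORD T6-93 (2) (b)); author F0P3a-p06 (g9), over ★ p837696
`ArchTorusOrbitalFunction` (this seat) and ★ `CompactGroupOrbitalIntegral` ∕ ★ `InvariantQuotientCompactSubgroup` (F0P3a-p08 (g11), road D1′c).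

WHAT IS PROVED (per place `w`, `G_w = archLocal L N (diagonal α) w = U(σ_w diag α)(ℂ)`, circle torus `T_w`, `ν` Haar on `G_w`, `t_T` Haar on `T_w`).
* §1 (ANY `G_w`, compact or not — only the torus is compact): `continuous_descConj_circleDiagonal`; **`integral_descConj_circleDiagonal_eq_inv_smul`** — for continuous `f`
  and EVERY `z ∈ (S¹)^N`, `F_f(z) := ∫ y, descConj (diag z) T_w _ f y ∂(dν ∕ dt_T) = t_T(T_w)⁻¹ • ∫_{G_w} f(g · diag z · g⁻¹) dν(g)` (★ `integral_quotientMeasure_eq_inv_smul`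
  at the COMPACT subgroup `T_w`); **`orbitalIntegral_circleDiagonal_eq_inv_smul`** — at a REGULAR `z`, with `ρ = t_T ∘ (Z(diag z) = T_w)⁻¹` (★ p837324's `t ⟨circleDiagonal N z, _⟩`),
  the Weil-form orbital integral ★ `orbitalIntegral (diag z) f (dν ∕ dρ)` is the same `t_T(T_w)⁻¹ • ∫_{G_w} f(g · diag z · g⁻¹) dν`.
* §2 (a DEFINITE place: `G_w` compact, `[CompactSpace]` binder to be fed with ★ `isCompact_archLocal_of_posDef`): `continuous_integral_conj_circleDiagonal`,
  **`continuous_integral_descConj_circleDiagonal`** (`z ↦ F_f(z)` is continuous on the WHOLE torus, singular points included), **`exists_bound_integral_descConj_circleDiagonal`**,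
  `continuous_prod_norm_sub_circle` ∕ `prod_norm_sub_circle_eq_zero_iff` (the per-place Weyl weight `∏_i ∏_{j≠i} |z_i − z_j| = D_{G_w}(diag z)²` is continuous and vanishes
  exactly at the non-injective `z`), **`tendsto_weylWeight_smul_integral_descConj_circleDiagonal`** — `D_{G_w}(diag z) · F_f(z) → 0` as `z → z₀` SINGULAR (print, L. 14.5.2 (b)
  proof: «`lim_{γ′→γ₀} D_G(γ′) Φ(γ′, f′_v) = 0` since `G′_v` is compact and `D_G(γ₀) = 0`»), and **`integral_conj_circleDiagonal_const`** — at a CENTRAL torus point `(ζ, …, ζ)`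
  the conjugation average is `ν(G_w) • f(ζ·1)` (★ `integral_conj_of_mem_center`) and **`integral_descConj_circleDiagonal_const`** — THE COMPACT-SIDE CENTRAL VALUE
  `F_f(ζ, …, ζ) = t_T(T_w)⁻¹ · ν(G_w) · f(ζ·1)` (the `c_{G′} a′(ζ)` side of (S-d), constant = the two visible masses).
So at a definite place the whole of (L-cpt) is a THEOREM of the tree; the non-compact place (`U(2,1)`: (L-H), (L-st)) is the letter.
HONEST LABEL: HC_CM is proved only modulo the printed citations until rung 0 closes; this file pays nothing by itself.

## References
* [Rogawski1990] J. D. Rogawski, *Automorphic Representations of Unitary Groups in Three Variables*, Ann. of Math. Stud. 123 (1990): §1.7 p. 6, §4.9 p. 54, §8.2 p. 122,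
  §14.5 p. 238 (proof of Lemma 14.5.2 (b)), p. 239 (central `γ₀`).
* [Shelstad1979] D. Shelstad, *Characters and inner forms of a quasi-split group over `ℝ`*, Compositio Math. 39 (1979), §4.
* [Folland1995] G. B. Folland, *A Course in Abstract Harmonic Analysis* (1995), §2.6 (2.52).
-/

set_option autoImplicit false

noncomputable section

open MeasureTheory Measure NumberField NumberField.InfinitePlace Filter Topology
open Literature.MeasureTheory.Group
open scoped Matrix MatrixGroups Finset

namespace Literature.NumberTheory.Automorphic.UnitaryGroup

section Place

variable (L : Type) [Field L] (N : ℕ) (α : Fin N → L) (w : {w : InfinitePlace L // IsComplex w})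
  {E : Type*} [NormedAddCommGroup E] [NormedSpace ℝ E]

omit [NormedSpace ℝ E] in
/-- The integrand `g T_w ↦ f(g · diag z · g⁻¹)` of the fixed-quotient torus term is continuous on `G_w ⧸ T_w` for continuous `f` (any `z`).
[cite: Rogawski1990, §8.2 p. 122] -/
theorem continuous_descConj_circleDiagonal (z : Fin N → Circle) (f : archLocal L N (Matrix.diagonal α) w → E) (hf : Continuous f) :
    Continuous (descConj (⟨circleDiagonal N z, circleDiagonal_mem_archLocal_diagonal L N α w z⟩ : archLocal L N (Matrix.diagonal α) w)
      ((circleDiagonal N).range.subgroupOf (archLocal L N (Matrix.diagonal α) w)) (circleTorus_comm_circleDiagonal L N α w z) f) := by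
  rw [(QuotientGroup.isQuotientMap_mk _).continuous_iff, descConj_comp_mk]
  exact hf.comp ((continuous_id.mul continuous_const).mul continuous_id.inv)

variable [LocallyCompactSpace (archLocal L N (Matrix.diagonal α) w)] [SecondCountableTopology (archLocal L N (Matrix.diagonal α) w)]
  [MeasurableSpace (archLocal L N (Matrix.diagonal α) w)] [BorelSpace (archLocal L N (Matrix.diagonal α) w)]
  (ν : Measure (archLocal L N (Matrix.diagonal α) w)) [ν.IsHaarMeasure] [ν.IsMulRightInvariant]
  (tT : Measure ((circleDiagonal N).range.subgroupOf (archLocal L N (Matrix.diagonal α) w))) [tT.IsHaarMeasure] [tT.IsInvInvariant]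
  [MeasurableSpace (archLocal L N (Matrix.diagonal α) w ⧸ (circleDiagonal N).range.subgroupOf (archLocal L N (Matrix.diagonal α) w))]
  [BorelSpace (archLocal L N (Matrix.diagonal α) w ⧸ (circleDiagonal N).range.subgroupOf (archLocal L N (Matrix.diagonal α) w))]

/-- **THE FIXED-QUOTIENT TORUS TERM UNFOLDED — AT EVERY `z`, IN ANY `G_w`**: since the circle torus `T_w` is COMPACT (★ `isCompact_circleTorus`), the quotient measure
`dν ∕ dt_T` on `G_w ⧸ T_w` is `t_T(T_w)⁻¹ • π_* ν` (★ `quotientMeasure_eq_inv_smul_map_mk`), so for continuous `f`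
`F_f(z) = ∫ y, descConj (diag z) T_w _ f y ∂(dν ∕ dt_T) = t_T(T_w)⁻¹ • ∫_{G_w} f(g · diag z · g⁻¹) dν(g)` — no regularity of `z` and no compactness of `G_w` needed
(the visible mass `t_T(T_w)` is print's normalisation datum). [cite: Rogawski1990, §1.7 p. 6; §8.2 p. 122] [cite: Folland1995, §2.6 (2.52)] -/
theorem integral_descConj_circleDiagonal_eq_inv_smul (z : Fin N → Circle) (f : archLocal L N (Matrix.diagonal α) w → E) (hf : Continuous f) :
    ∫ y, descConj (⟨circleDiagonal N z, circleDiagonal_mem_archLocal_diagonal L N α w z⟩ : archLocal L N (Matrix.diagonal α) w)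
        ((circleDiagonal N).range.subgroupOf (archLocal L N (Matrix.diagonal α) w)) (circleTorus_comm_circleDiagonal L N α w z) f y
        ∂(quotientMeasure _ tT (isClosed_circleTorus L N α w) ν) =
      (tT.real Set.univ)⁻¹ •
        ∫ g, f (g * ⟨circleDiagonal N z, circleDiagonal_mem_archLocal_diagonal L N α w z⟩ * g⁻¹) ∂ν := by
  haveI : CompactSpace ((circleDiagonal N).range.subgroupOf (archLocal L N (Matrix.diagonal α) w)) :=
    isCompact_iff_compactSpace.mp (isCompact_circleTorus L N α w)
  haveI : IsClosed (((circleDiagonal N).range.subgroupOf (archLocal L N (Matrix.diagonal α) w) : Subgroup (archLocal L N (Matrix.diagonal α) w)) :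
      Set (archLocal L N (Matrix.diagonal α) w)) :=
    isClosed_circleTorus L N α w
  rw [integral_quotientMeasure_eq_inv_smul _ tT ν _ (continuous_descConj_circleDiagonal L N α w z f hf).stronglyMeasurable]
  rfl

/-- **THE REGULAR-POINT WEIL-FORM ORBITAL INTEGRAL UNFOLDED**: for injective `z` and `ρ = t_T ∘ (Z(diag z) = T_w)⁻¹` (★ p837324's `t ⟨circleDiagonal N z, _⟩`),
`orbitalIntegral (diag z) f (dν ∕ dρ) = t_T(T_w)⁻¹ • ∫_{G_w} f(g · diag z · g⁻¹) dν(g)` (★ `orbitalIntegral_circleDiagonal_eq_integral_descConj` + the previous lemma).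
[cite: Rogawski1990, §4.9 p. 54; §1.7 p. 6] [cite: Folland1995, §2.6 (2.52)] -/
theorem orbitalIntegral_circleDiagonal_eq_inv_smul (hα : ∀ i, α i ≠ 0) {z : Fin N → Circle} (hz : Function.Injective z)
    (ρ : Measure (Subgroup.centralizer
      ({(⟨circleDiagonal N z, circleDiagonal_mem_archLocal_diagonal L N α w z⟩ : archLocal L N (Matrix.diagonal α) w)} :
        Set (archLocal L N (Matrix.diagonal α) w))))
    [ρ.IsHaarMeasure] [ρ.IsInvInvariant]
    (hρ : ρ = tT.map (MulEquiv.subgroupCongr (centralizer_circleDiagonal_eq_subgroupOf L N α w hα hz).symm))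
    [MeasurableSpace (archLocal L N (Matrix.diagonal α) w ⧸ Subgroup.centralizer
      ({(⟨circleDiagonal N z, circleDiagonal_mem_archLocal_diagonal L N α w z⟩ : archLocal L N (Matrix.diagonal α) w)} :
        Set (archLocal L N (Matrix.diagonal α) w)))]
    [BorelSpace (archLocal L N (Matrix.diagonal α) w ⧸ Subgroup.centralizer
      ({(⟨circleDiagonal N z, circleDiagonal_mem_archLocal_diagonal L N α w z⟩ : archLocal L N (Matrix.diagonal α) w)} :
        Set (archLocal L N (Matrix.diagonal α) w)))]
    (f : archLocal L N (Matrix.diagonal α) w → E) (hf : Continuous f) :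
    orbitalIntegral (⟨circleDiagonal N z, circleDiagonal_mem_archLocal_diagonal L N α w z⟩ : archLocal L N (Matrix.diagonal α) w) f
        (quotientMeasure _ ρ (isClosed_coe_centralizer_singleton _) ν) =
      (tT.real Set.univ)⁻¹ •
        ∫ g, f (g * ⟨circleDiagonal N z, circleDiagonal_mem_archLocal_diagonal L N α w z⟩ * g⁻¹) ∂ν := by
  rw [orbitalIntegral_circleDiagonal_eq_integral_descConj L N α w hα ν tT hz ρ hρ f, integral_descConj_circleDiagonal_eq_inv_smul L N α w ν tT z f hf]

end Place

/-! ## §2 At a DEFINITE place (`G_w` compact): `F_f` is continuous and bounded on the WHOLE torus, and `D^{1∕2} F_f → 0` at the singular points -/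

section Compact

variable (L : Type) [Field L] (N : ℕ) (α : Fin N → L) (w : {w : InfinitePlace L // IsComplex w})
  [CompactSpace (archLocal L N (Matrix.diagonal α) w)]
  [LocallyCompactSpace (archLocal L N (Matrix.diagonal α) w)] [SecondCountableTopology (archLocal L N (Matrix.diagonal α) w)]
  [MeasurableSpace (archLocal L N (Matrix.diagonal α) w)] [BorelSpace (archLocal L N (Matrix.diagonal α) w)]
  (ν : Measure (archLocal L N (Matrix.diagonal α) w)) [ν.IsHaarMeasure]
  {E : Type*} [NormedAddCommGroup E] [NormedSpace ℝ E]

/-- **At a definite place the conjugation average `z ↦ ∫_{G_w} f(g · diag z · g⁻¹) dν` is CONTINUOUS ON THE WHOLE TORUS `(S¹)^N`** (singular points included;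
★ `continuous_integral_conj` of the compact group composed with the continuous torus map). [cite: Rogawski1990, §14.5 p. 238] [cite: Shelstad1979, §4] -/
theorem continuous_integral_conj_circleDiagonal (f : archLocal L N (Matrix.diagonal α) w → E) (hf : Continuous f) :
    Continuous fun z : Fin N → Circle =>
      ∫ g, f (g * ⟨circleDiagonal N z, circleDiagonal_mem_archLocal_diagonal L N α w z⟩ * g⁻¹) ∂ν :=
  (continuous_integral_conj ν f hf).comp ((continuous_circleDiagonal N).subtype_mk _)

/-- **At a definite place `F_f` is continuous on the whole torus.** [cite: Rogawski1990, §14.5 p. 238] [cite: Shelstad1979, §4] -/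
theorem continuous_integral_descConj_circleDiagonal [ν.IsMulRightInvariant]
    (tT : Measure ((circleDiagonal N).range.subgroupOf (archLocal L N (Matrix.diagonal α) w))) [tT.IsHaarMeasure] [tT.IsInvInvariant]
    [MeasurableSpace (archLocal L N (Matrix.diagonal α) w ⧸ (circleDiagonal N).range.subgroupOf (archLocal L N (Matrix.diagonal α) w))]
    [BorelSpace (archLocal L N (Matrix.diagonal α) w ⧸ (circleDiagonal N).range.subgroupOf (archLocal L N (Matrix.diagonal α) w))]
    (f : archLocal L N (Matrix.diagonal α) w → E) (hf : Continuous f) :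
    Continuous fun z : Fin N → Circle =>
      ∫ y, descConj (⟨circleDiagonal N z, circleDiagonal_mem_archLocal_diagonal L N α w z⟩ : archLocal L N (Matrix.diagonal α) w)
        ((circleDiagonal N).range.subgroupOf (archLocal L N (Matrix.diagonal α) w)) (circleTorus_comm_circleDiagonal L N α w z) f y
        ∂(quotientMeasure _ tT (isClosed_circleTorus L N α w) ν) := by
  have h : (fun z : Fin N → Circle =>
      ∫ y, descConj (⟨circleDiagonal N z, circleDiagonal_mem_archLocal_diagonal L N α w z⟩ : archLocal L N (Matrix.diagonal α) w)
        ((circleDiagonal N).range.subgroupOf (archLocal L N (Matrix.diagonal α) w)) (circleTorus_comm_circleDiagonal L N α w z) f y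
        ∂(quotientMeasure _ tT (isClosed_circleTorus L N α w) ν)) =
      fun z => (tT.real Set.univ)⁻¹ • ∫ g, f (g * ⟨circleDiagonal N z, circleDiagonal_mem_archLocal_diagonal L N α w z⟩ * g⁻¹) ∂ν :=
    funext fun z => integral_descConj_circleDiagonal_eq_inv_smul L N α w ν tT z f hf
  rw [h]
  exact (continuous_integral_conj_circleDiagonal L N α w ν f hf).const_smul _

/-- **At a definite place `F_f` is BOUNDED on the torus** (continuous on the compact `(S¹)^N`). [cite: Rogawski1990, §14.5 p. 239] [cite: Shelstad1979, §4] -/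
theorem exists_bound_integral_descConj_circleDiagonal [ν.IsMulRightInvariant]
    (tT : Measure ((circleDiagonal N).range.subgroupOf (archLocal L N (Matrix.diagonal α) w))) [tT.IsHaarMeasure] [tT.IsInvInvariant]
    [MeasurableSpace (archLocal L N (Matrix.diagonal α) w ⧸ (circleDiagonal N).range.subgroupOf (archLocal L N (Matrix.diagonal α) w))]
    [BorelSpace (archLocal L N (Matrix.diagonal α) w ⧸ (circleDiagonal N).range.subgroupOf (archLocal L N (Matrix.diagonal α) w))]
    (f : archLocal L N (Matrix.diagonal α) w → E) (hf : Continuous f) :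
    ∃ C : ℝ, ∀ z : Fin N → Circle,
      ‖∫ y, descConj (⟨circleDiagonal N z, circleDiagonal_mem_archLocal_diagonal L N α w z⟩ : archLocal L N (Matrix.diagonal α) w)
        ((circleDiagonal N).range.subgroupOf (archLocal L N (Matrix.diagonal α) w)) (circleTorus_comm_circleDiagonal L N α w z) f y
        ∂(quotientMeasure _ tT (isClosed_circleTorus L N α w) ν)‖ ≤ C := by
  obtain ⟨C, hC⟩ := isCompact_univ.exists_bound_of_continuousOn (continuous_integral_descConj_circleDiagonal L N α w ν tT f hf).continuousOn
  exact ⟨C, fun z => hC z (Set.mem_univ z)⟩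

omit [CompactSpace (archLocal L N (Matrix.diagonal α) w)] [LocallyCompactSpace (archLocal L N (Matrix.diagonal α) w)]
  [SecondCountableTopology (archLocal L N (Matrix.diagonal α) w)] [MeasurableSpace (archLocal L N (Matrix.diagonal α) w)]
  [BorelSpace (archLocal L N (Matrix.diagonal α) w)] [ν.IsHaarMeasure] in
/-- The per-place Weyl weight `∏_i ∏_{j≠i} |z_i − z_j|` (= `D_{G_w}(diag z)²`, ★ `normAtPlace_matrix_discr_diagonal`) is continuous in `z` and VANISHES exactly at the
non-injective (singular) `z`. [cite: Rogawski1990, §4.9 p. 54] -/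
theorem continuous_prod_norm_sub_circle :
    Continuous fun z : Fin N → Circle => ∏ i, ∏ j ∈ Finset.univ.erase i, ‖(z i : ℂ) - z j‖ :=
  continuous_finsetProd _ fun i _ => continuous_finsetProd _ fun j _ =>
    ((continuous_subtype_val.comp (continuous_apply i)).sub (continuous_subtype_val.comp (continuous_apply j))).norm

omit [CompactSpace (archLocal L N (Matrix.diagonal α) w)] [LocallyCompactSpace (archLocal L N (Matrix.diagonal α) w)]
  [SecondCountableTopology (archLocal L N (Matrix.diagonal α) w)] [MeasurableSpace (archLocal L N (Matrix.diagonal α) w)]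
  [BorelSpace (archLocal L N (Matrix.diagonal α) w)] [ν.IsHaarMeasure] in
/-- `∏_i ∏_{j≠i} |z_i − z_j| = 0` iff `z` is NOT injective. [cite: Rogawski1990, §4.9 p. 54; §3.1 p. 19] -/
theorem prod_norm_sub_circle_eq_zero_iff (z : Fin N → Circle) :
    (∏ i, ∏ j ∈ Finset.univ.erase i, ‖(z i : ℂ) - z j‖) = 0 ↔ ¬ Function.Injective z := by
  simp only [Finset.prod_eq_zero_iff, Finset.mem_univ, true_and, Finset.mem_erase, norm_eq_zero, sub_eq_zero, Circle.coe_inj,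
    Function.Injective, not_forall]
  constructor
  · rintro ⟨i, j, ⟨hji, -⟩, hij⟩
    exact ⟨i, j, hij, fun h => hji h.symm⟩
  · rintro ⟨i, j, hij, hne⟩
    exact ⟨i, j, ⟨fun h => hne h.symm, trivial⟩, hij⟩

/-- **(L-cpt), SECOND HALF: `D(diag z)^{1∕2} · F_f(z) → 0` AS `z → z₀` SINGULAR, at a definite place** — `F_f` is bounded and the weight is continuous with value `0` at
`z₀` (print: «`lim_{γ′ → γ₀} D_G(γ′) Φ(γ′, f′_v) = 0` since `G′_v` is compact and `D_G(γ₀) = 0`»).  The weight is written `(∏_i ∏_{j≠i} |z_i − z_j|)^{1∕2} = D_{G_w}(diag z)`.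
[cite: Rogawski1990, §14.5 p. 238, proof of Lemma 14.5.2 (b)] [cite: Shelstad1979, §4] -/
theorem tendsto_weylWeight_smul_integral_descConj_circleDiagonal [ν.IsMulRightInvariant]
    (tT : Measure ((circleDiagonal N).range.subgroupOf (archLocal L N (Matrix.diagonal α) w))) [tT.IsHaarMeasure] [tT.IsInvInvariant]
    [MeasurableSpace (archLocal L N (Matrix.diagonal α) w ⧸ (circleDiagonal N).range.subgroupOf (archLocal L N (Matrix.diagonal α) w))]
    [BorelSpace (archLocal L N (Matrix.diagonal α) w ⧸ (circleDiagonal N).range.subgroupOf (archLocal L N (Matrix.diagonal α) w))]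
    (f : archLocal L N (Matrix.diagonal α) w → E) (hf : Continuous f)
    {z₀ : Fin N → Circle} (hz₀ : ¬ Function.Injective z₀) :
    Tendsto (fun z : Fin N → Circle =>
        (∏ i, ∏ j ∈ Finset.univ.erase i, ‖(z i : ℂ) - z j‖) ^ (1 / 2 : ℝ) •
          ∫ y, descConj (⟨circleDiagonal N z, circleDiagonal_mem_archLocal_diagonal L N α w z⟩ : archLocal L N (Matrix.diagonal α) w)
            ((circleDiagonal N).range.subgroupOf (archLocal L N (Matrix.diagonal α) w)) (circleTorus_comm_circleDiagonal L N α w z) f y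
            ∂(quotientMeasure _ tT (isClosed_circleTorus L N α w) ν))
      (𝓝 z₀) (𝓝 0) := by
  have hw : Tendsto (fun z : Fin N → Circle => (∏ i, ∏ j ∈ Finset.univ.erase i, ‖(z i : ℂ) - z j‖) ^ (1 / 2 : ℝ)) (𝓝 z₀) (𝓝 0) := by
    have h0 : (∏ i, ∏ j ∈ Finset.univ.erase i, ‖(z₀ i : ℂ) - z₀ j‖) ^ (1 / 2 : ℝ) = 0 := by
      rw [(prod_norm_sub_circle_eq_zero_iff N z₀).mpr hz₀, Real.zero_rpow (by norm_num)]
    rw [← h0]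
    exact (((continuous_prod_norm_sub_circle N).rpow_const fun z => Or.inr (by norm_num)).tendsto z₀)
  have hF := (continuous_integral_descConj_circleDiagonal L N α w ν tT f hf).tendsto z₀
  rw [← zero_smul ℝ (∫ y, descConj (⟨circleDiagonal N z₀, circleDiagonal_mem_archLocal_diagonal L N α w z₀⟩ : archLocal L N (Matrix.diagonal α) w)
    ((circleDiagonal N).range.subgroupOf (archLocal L N (Matrix.diagonal α) w)) (circleTorus_comm_circleDiagonal L N α w z₀) f y
    ∂(quotientMeasure _ tT (isClosed_circleTorus L N α w) ν))]
  exact hw.smul hF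

omit [CompactSpace (archLocal L N (Matrix.diagonal α) w)] [LocallyCompactSpace (archLocal L N (Matrix.diagonal α) w)]
  [SecondCountableTopology (archLocal L N (Matrix.diagonal α) w)] [BorelSpace (archLocal L N (Matrix.diagonal α) w)] [ν.IsHaarMeasure] in
/-- **At a definite place, at a CENTRAL torus point `z = (ζ, …, ζ)` the conjugation average is `ν(G_w) • f(ζ·1)`** («the limit is evaluation»: ★ `integral_conj_of_mem_center`;
`diag(ζ, …, ζ)` is central in `G_w`). [cite: Rogawski1990, §14.5 p. 239] -/
theorem integral_conj_circleDiagonal_const [CompleteSpace E] (f : archLocal L N (Matrix.diagonal α) w → E) (ζ : Circle) :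
    ∫ g, f (g * ⟨circleDiagonal N (fun _ => ζ), circleDiagonal_mem_archLocal_diagonal L N α w _⟩ * g⁻¹) ∂ν =
      ν.real Set.univ • f ⟨circleDiagonal N (fun _ => ζ), circleDiagonal_mem_archLocal_diagonal L N α w _⟩ := by
  refine integral_conj_of_mem_center ν f (Subgroup.mem_center_iff.mpr fun g => ?_)
  apply Subtype.ext; apply Units.ext
  change (g : GL (Fin N) ℂ).val * (circleDiagonal N fun _ => ζ).val = (circleDiagonal N fun _ => ζ).val * (g : GL (Fin N) ℂ).val
  rw [coe_circleDiagonal]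
  change (g : GL (Fin N) ℂ).val * Matrix.diagonal (fun _ : Fin N => (ζ : ℂ)) = Matrix.diagonal (fun _ : Fin N => (ζ : ℂ)) * (g : GL (Fin N) ℂ).val
  rw [← Matrix.scalar_apply, Matrix.scalar_commute]
  exact fun _ => Commute.all _ _

omit [CompactSpace (archLocal L N (Matrix.diagonal α) w)] in
/-- **THE COMPACT-SIDE CENTRAL VALUE: `F_f(ζ, …, ζ) = t_T(T_w)⁻¹ · ν(G_w) · f(ζ·1)`** at a definite place — the value the fixed-quotient torus term takes AT a central
point (no limit needed on the compact side: `F_f` is continuous there); the `c_{G′} · a′(ζ)` side of the central-value comparison (S-d) [§8.4 p. 127, §14.5 p. 239],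
with print's constant made of the two VISIBLE masses `ν(G_w)`, `t_T(T_w)` (stated for any `G_w`; off the compact case both sides degenerate to `0`, `ν(G_w) = ∞`).
[cite: Rogawski1990, §14.5 p. 239; §8.4 pp. 126–127] [cite: Folland1995, §2.6 (2.52)] -/
theorem integral_descConj_circleDiagonal_const [CompleteSpace E] [ν.IsMulRightInvariant]
    (tT : Measure ((circleDiagonal N).range.subgroupOf (archLocal L N (Matrix.diagonal α) w))) [tT.IsHaarMeasure] [tT.IsInvInvariant]
    [MeasurableSpace (archLocal L N (Matrix.diagonal α) w ⧸ (circleDiagonal N).range.subgroupOf (archLocal L N (Matrix.diagonal α) w))]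
    [BorelSpace (archLocal L N (Matrix.diagonal α) w ⧸ (circleDiagonal N).range.subgroupOf (archLocal L N (Matrix.diagonal α) w))]
    (f : archLocal L N (Matrix.diagonal α) w → E) (hf : Continuous f) (ζ : Circle) :
    ∫ y, descConj (⟨circleDiagonal N (fun _ => ζ), circleDiagonal_mem_archLocal_diagonal L N α w _⟩ : archLocal L N (Matrix.diagonal α) w)
        ((circleDiagonal N).range.subgroupOf (archLocal L N (Matrix.diagonal α) w)) (circleTorus_comm_circleDiagonal L N α w _) f y
        ∂(quotientMeasure _ tT (isClosed_circleTorus L N α w) ν) =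
      ((tT.real Set.univ)⁻¹ * ν.real Set.univ) • f ⟨circleDiagonal N (fun _ => ζ), circleDiagonal_mem_archLocal_diagonal L N α w _⟩ := by
  rw [integral_descConj_circleDiagonal_eq_inv_smul L N α w ν tT _ f hf, integral_conj_circleDiagonal_const L N α w ν f ζ, smul_smul]

end Compact

end Literature.NumberTheory.Automorphic.UnitaryGroup
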